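import Literature.Topology.FourManifolds.CappellShanesonClassNumberTwoUnits
import HarnessLib

/-!
# Units of a cubic field modulo squares from signs at three real places

For a cubic number field `K` with three real embeddings `ρ₀, ρ₁, ρ₂ : K → ℝ` and two units
`e₁, e₂ ∈ 𝓞_Kˣ` whose sign vectors together with that of `-1` are independent over `𝔽₂`,
Dirichlet's unit theorem (`rank ≤ 2`, torsion `±1`; the tree's
`Literature.Topology.FourManifolds.exists_rep_mul_sq`) gives at most `8` classes in
`𝓞_Kˣ/(𝓞_Kˣ)²`, and the `8` products `± e₁^a e₂^b` realise `8` distinct sign vectors. Hence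
(`UnitSignature.isSquare_of_forall_pos`) a totally positive unit is a square, and
(`UnitSignature.exists_rep_mul_sq`) every unit is `± e₁^a e₂^b η²`. The sign data enter as
Booleans `n₁ n₂ : Fin 3 → Bool` ("`eᵢ` is negative at `ρⱼ`") with the decidable independence
hypothesis `hind`. (This is the real-place version of the residue-signature argument of
`…F3CubicK13Units.lean`; cf. the concrete `CyclicCubicField13.lean`.) Theorems only.
[cite: Marcus2018, Ch. 5, Thm. 38]

## References

* D. A. Marcus, *Number Fields*, 2nd ed. (2018), Ch. 5, Thm. 38 (Dirichlet's unit theorem).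
  [cite: Marcus2018, Ch. 5, Thm. 38]
-/

noncomputable section

open scoped NumberField

open NumberField Module

namespace Literature.NumberTheory.NumberFields

namespace UnitSignature

variable {K : Type*} [Field K] [NumberField K]

/-- The negativity bit of a unit at a real embedding. [folklore] -/
def negBit (ρ : K →+* ℝ) (y : (𝓞 K)ˣ) : Bool := decide (ρ ((y : 𝓞 K) : K) < 0)

omit [NumberField K] in
/-- A unit is non-zero at every embedding. [folklore] -/
theorem embedding_ne_zero (ρ : K →+* ℝ) (y : (𝓞 K)ˣ) : ρ ((y : 𝓞 K) : K) ≠ 0 :=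
  (map_ne_zero ρ).mpr (by exact_mod_cast y.ne_zero)

omit [NumberField K] in
/-- `negBit` is additive (signs multiply). [folklore] -/
theorem negBit_mul (ρ : K →+* ℝ) (y z : (𝓞 K)ˣ) :
    negBit ρ (y * z) = xor (negBit ρ y) (negBit ρ z) := by
  have hy := embedding_ne_zero ρ y
  have hz := embedding_ne_zero ρ z
  simp only [negBit, Units.val_mul, map_mul]
  rcases lt_or_gt_of_ne hy with hy | hy <;> rcases lt_or_gt_of_ne hz with hz | hz
  · have := mul_pos_of_neg_of_neg hy hz
    simp [hy, hz, not_lt.mpr this.le]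
  · have := mul_neg_of_neg_of_pos hy hz
    simp [hy, this, not_lt.mpr hz.le]
  · have := mul_neg_of_pos_of_neg hy hz
    simp [this, hz, not_lt.mpr hy.le]
  · have := mul_pos hy hz
    simp [not_lt.mpr this.le, not_lt.mpr hy.le, not_lt.mpr hz.le]

omit [NumberField K] in
/-- Squares are positive: `negBit ρ (η²) = false`. [folklore] -/
theorem negBit_sq (ρ : K →+* ℝ) (η : (𝓞 K)ˣ) : negBit ρ (η ^ 2) = false := by
  rw [sq, negBit_mul, Bool.xor_self]

omit [NumberField K] in
/-- `negBit ρ (-1) = true`. [folklore] -/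
theorem negBit_neg_one (ρ : K →+* ℝ) : negBit ρ (-1 : (𝓞 K)ˣ) = true := by
  simp [negBit, Units.val_neg, Units.val_one, map_neg, map_one]

omit [NumberField K] in
/-- `negBit ρ 1 = false`. [folklore] -/
theorem negBit_one (ρ : K →+* ℝ) : negBit ρ (1 : (𝓞 K)ˣ) = false := by
  simp [negBit, Units.val_one, map_one]

omit [NumberField K] in
/-- `negBit` of a power `y ^ n`, `n ∈ {0, 1}`. [folklore] -/
theorem negBit_pow_fin_two (ρ : K →+* ℝ) (y : (𝓞 K)ˣ) (a : Fin 2) :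
    negBit ρ (y ^ (a : ℕ)) = (decide (a = 1) && negBit ρ y) := by
  fin_cases a
  · simp [negBit_one]
  · simp

omit [NumberField K] in
/-- Inverses have the same sign: `negBit ρ y⁻¹ = negBit ρ y`. [folklore] -/
theorem negBit_inv (ρ : K →+* ℝ) (y : (𝓞 K)ˣ) : negBit ρ y⁻¹ = negBit ρ y := by
  have h := negBit_mul ρ y y⁻¹
  rw [mul_inv_cancel, negBit_one] at h
  revert h
  cases negBit ρ y <;> cases negBit ρ y⁻¹ <;> simp

/-- The predicted negativity bit of `(-1)^s e₁^a e₂^b` at place `j` from the bits `n₁, n₂` of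
`e₁, e₂`. [folklore] -/
def predBit (n₁ n₂ : Fin 3 → Bool) (e : Fin 2 × Fin 2 × Fin 2) (j : Fin 3) : Bool :=
  xor (decide (e.1 = 1)) (xor (decide (e.2.1 = 1) && n₁ j) (decide (e.2.2 = 1) && n₂ j))

/-- The representatives `(-1)^s e₁^a e₂^b`. [folklore] -/
def rep (e₁ e₂ : (𝓞 K)ˣ) (e : Fin 2 × Fin 2 × Fin 2) : (𝓞 K)ˣ :=
  (-1) ^ (e.1 : ℕ) * e₁ ^ (e.2.1 : ℕ) * e₂ ^ (e.2.2 : ℕ)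

/-- **The sign vectors of the representatives, and injectivity of the unit signature.** With
`-1, e₁, e₂` of independent sign vectors at three real embeddings: (1) the sign vector of
`rep e` is `predBit e`; (2) two units with the same sign vector differ by a square.
[cite: Marcus2018, Ch. 5, Thm. 38] -/
theorem eq_mul_sq_of_negBit_eq (h3 : finrank ℚ K = 3) (ρ : Fin 3 → (K →+* ℝ))
    (e₁ e₂ : (𝓞 K)ˣ) (n₁ n₂ : Fin 3 → Bool)
    (hn₁ : ∀ j, negBit (ρ j) e₁ = n₁ j) (hn₂ : ∀ j, negBit (ρ j) e₂ = n₂ j)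
    (hind : ∀ e e' : Fin 2 × Fin 2 × Fin 2,
      (∀ j, predBit n₁ n₂ e j = predBit n₁ n₂ e' j) → e = e')
    (x y : (𝓞 K)ˣ) (hxy : ∀ j, negBit (ρ j) x = negBit (ρ j) y) :
    ∃ η : (𝓞 K)ˣ, x = y * η ^ 2 := by
  classical
  -- the signature
  let σ : (𝓞 K)ˣ → (Fin 3 → Bool) := fun z j => negBit (ρ j) z
  have hσmul : ∀ z w, σ (z * w) = fun j => xor (σ z j) (σ w j) := fun z w => by
    funext j; exact negBit_mul (ρ j) z w
  have hσsq : ∀ η, σ (η ^ 2) = fun _ => false := fun η => by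
    funext j; exact negBit_sq (ρ j) η
  have hσinv : ∀ z, σ z⁻¹ = σ z := fun z => by funext j; exact negBit_inv (ρ j) z
  have hσrep : ∀ e, σ (rep e₁ e₂ e) = predBit n₁ n₂ e := by
    intro e
    funext j
    simp only [σ, rep, negBit_mul, negBit_pow_fin_two, hn₁, hn₂, predBit, negBit_neg_one,
      Bool.and_true, Bool.xor_assoc]
  -- Dirichlet: every unit is `ρ'(d) η²` over Mathlib's fundamental system, `≤ 8` classes
  set F := NumberField.Units.fundSystem K with hF
  let E := Fin 2 × (Fin (NumberField.Units.rank K) → Fin 2)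
  let ρ' : E → (𝓞 K)ˣ := fun d => (-1) ^ (d.1 : ℕ) * ∏ i, F i ^ ((d.2 i : ℕ))
  have hcardE : Fintype.card E ≤ 8 := by
    have hr := Literature.Topology.FourManifolds.units_rank_le_two (K := K) h3
    simp only [E, Fintype.card_prod, Fintype.card_fun, Fintype.card_fin]
    calc 2 * 2 ^ NumberField.Units.rank K ≤ 2 * 2 ^ 2 :=
          Nat.mul_le_mul_left 2 (Nat.pow_le_pow_right (by norm_num) hr)
      _ = 8 := by norm_num
  have hred : ∀ z : (𝓞 K)ˣ, ∃ (d : E) (η : (𝓞 K)ˣ), z = ρ' d * η ^ 2 := by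
    intro z
    obtain ⟨s, ε, η, hz⟩ := Literature.Topology.FourManifolds.exists_rep_mul_sq h3 z
    exact ⟨(s, ε), η, hz⟩
  -- every bit vector is realised: `predBit` is a bijection of `8`-element sets
  have hbij : Function.Bijective (predBit n₁ n₂) := by
    rw [Fintype.bijective_iff_injective_and_card]
    refine ⟨fun e e' h => hind e e' (fun j => by rw [h]), by simp⟩
  have hsurj : (Finset.univ : Finset (Fin 3 → Bool)) ⊆ Finset.univ.image (σ ∘ ρ') := by
    intro v _
    obtain ⟨e, he⟩ := hbij.2 v
    obtain ⟨d, η, hd⟩ := hred (rep e₁ e₂ e)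
    refine Finset.mem_image.mpr ⟨d, Finset.mem_univ d, ?_⟩
    have : σ (rep e₁ e₂ e) = σ (ρ' d) := by
      rw [hd, hσmul, hσsq]; funext j; simp
    rw [Function.comp_apply, ← this, hσrep, he]
  have hinj : Set.InjOn (σ ∘ ρ') (Finset.univ : Finset E) := by
    rw [← Finset.card_image_iff]
    apply le_antisymm Finset.card_image_le
    calc (Finset.univ : Finset E).card = Fintype.card E := Finset.card_univ
      _ ≤ 8 := hcardE
      _ = (Finset.univ : Finset (Fin 3 → Bool)).card := by simp
      _ ≤ (Finset.univ.image (σ ∘ ρ')).card := Finset.card_le_card hsurj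
  -- conclusion: `x = ρ'(d) η²`, `y = ρ'(d') η'²` with `σ (ρ' d) = σ (ρ' d')`, so `d = d'`
  obtain ⟨d, η, hd⟩ := hred x
  obtain ⟨d', η', hd'⟩ := hred y
  have hσxy : σ x = σ y := funext hxy
  have hdd : σ (ρ' d) = σ (ρ' d') := by
    have hx' : σ x = σ (ρ' d) := by rw [hd, hσmul, hσsq]; funext j; simp
    have hy' : σ y = σ (ρ' d') := by rw [hd', hσmul, hσsq]; funext j; simp
    rw [← hx', ← hy', hσxy]
  have hdeq : d = d' := hinj (Finset.mem_univ _) (Finset.mem_univ _) hdd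
  subst hdeq
  refine ⟨η'⁻¹ * η, ?_⟩
  calc x = ρ' d * η ^ 2 := hd
    _ = (ρ' d * η' ^ 2) * (η'⁻¹ * η) ^ 2 := by rw [mul_pow, inv_pow]; group
    _ = y * (η'⁻¹ * η) ^ 2 := by rw [← hd']

/-- **A totally positive unit is a square** (`-1, e₁, e₂` of independent sign vectors).
[cite: Marcus2018, Ch. 5, Thm. 38] -/
theorem isSquare_of_forall_pos (h3 : finrank ℚ K = 3) (ρ : Fin 3 → (K →+* ℝ))
    (e₁ e₂ : (𝓞 K)ˣ) (n₁ n₂ : Fin 3 → Bool)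
    (hn₁ : ∀ j, negBit (ρ j) e₁ = n₁ j) (hn₂ : ∀ j, negBit (ρ j) e₂ = n₂ j)
    (hind : ∀ e e' : Fin 2 × Fin 2 × Fin 2,
      (∀ j, predBit n₁ n₂ e j = predBit n₁ n₂ e' j) → e = e')
    (x : (𝓞 K)ˣ) (hx : ∀ j, 0 < ρ j ((x : 𝓞 K) : K)) : ∃ η : (𝓞 K)ˣ, x = η ^ 2 := by
  obtain ⟨η, hη⟩ := eq_mul_sq_of_negBit_eq h3 ρ e₁ e₂ n₁ n₂ hn₁ hn₂ hind x 1 fun j => by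
    rw [negBit_one]; simp [negBit, not_lt.mpr (hx j).le]
  exact ⟨η, by rw [hη, one_mul]⟩

/-- **Units modulo squares**: every unit is `(-1)^s e₁^a e₂^b η²` with `s, a, b ∈ {0, 1}`
(`-1, e₁, e₂` of independent sign vectors). [cite: Marcus2018, Ch. 5, Thm. 38] -/
theorem exists_rep_mul_sq (h3 : finrank ℚ K = 3) (ρ : Fin 3 → (K →+* ℝ))
    (e₁ e₂ : (𝓞 K)ˣ) (n₁ n₂ : Fin 3 → Bool)
    (hn₁ : ∀ j, negBit (ρ j) e₁ = n₁ j) (hn₂ : ∀ j, negBit (ρ j) e₂ = n₂ j)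
    (hind : ∀ e e' : Fin 2 × Fin 2 × Fin 2,
      (∀ j, predBit n₁ n₂ e j = predBit n₁ n₂ e' j) → e = e')
    (x : (𝓞 K)ˣ) : ∃ (s a b : Fin 2) (η : (𝓞 K)ˣ),
      x = (-1) ^ (s : ℕ) * e₁ ^ (a : ℕ) * e₂ ^ (b : ℕ) * η ^ 2 := by
  classical
  have hbij : Function.Bijective (predBit n₁ n₂) := by
    rw [Fintype.bijective_iff_injective_and_card]
    refine ⟨fun e e' h => hind e e' (fun j => by rw [h]), by simp⟩
  obtain ⟨e, he⟩ := hbij.2 fun j => negBit (ρ j) x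
  obtain ⟨η, hη⟩ := eq_mul_sq_of_negBit_eq h3 ρ e₁ e₂ n₁ n₂ hn₁ hn₂ hind x (rep e₁ e₂ e)
    fun j => by
      have h1 : negBit (ρ j) (rep e₁ e₂ e) = predBit n₁ n₂ e j := by
        simp only [rep, negBit_mul, negBit_pow_fin_two, hn₁, hn₂, predBit, negBit_neg_one,
          Bool.and_true, Bool.xor_assoc]
      rw [h1, he]
  exact ⟨e.1, e.2.1, e.2.2, η, by rw [hη]; rfl⟩

end UnitSignature

end Literature.NumberTheory.NumberFields

end
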